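import Summits.ResolutionOfSingularities.ResolutionOfSingularities.Theorems.HilbertSamuelEliminationSigmaMaxModificationsCorridor3SigmaMenuCorners
import HarnessLib

/-!
# [OURS · L1 W4.2] σ-LAYER (E3) — `Corridor3SigmaBirthDictionary3`: the BOUNDARY-CORNER SIZE of a point and how it moves along ONE blow-up
# («full-corner births land in the partial-frame cells»), after res-L1-w42-plan-1 RULING v3.14-17 (EZ)(iv) / object (FA)

Crux chain w42 (`SigmaMaxModifications`, stmt-ResolutionOfSingularities-18506; conjunct `SigmaMaxModificationsCorridor3`, stmt-ResolutionOfSingularities-19249),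
σ-layer; typer res-type-067 (g12), standing reader res-type-053. OURS (cell res-hironaka, slot W4.2); NOT statements of H. Hironaka's manuscript
[Hironaka2017] nor of [CossartJannsenSaito2020] / [Kollar2007]; AI-typed, weaker than expert review. Helper VOCABULARY + proved bookkeeping,
`--supports stmt-ResolutionOfSingularities-19249 --as helper` (counted 0); NO row is claimed. Additive over my `…SigmaMenuDefs` / `…SigmaMenuCorners`
(`membersThrough`, `IsFullCorner`, `Boundary.PairsMeetNewFinite`) and o1's `…SigmaBoundaryDefs` (`Boundary.next`, `CanonicalNearStepσE`).

## §0. Dictionary ((EZ)(iv), planner's hand finding, OURS): WHERE BIRTHS LIVE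

Blow up a FULL CORNER point `x` (three boundary members `E₁, E₂, E₃ ∋ x`) of the `ν`-stratum. A point `x'` of the new exceptional member
`F = V(C·𝒪_{Bl})` lies on the strict transforms of SOME of the old members; in the toric/torus-fixed frame the points on TWO old strict transforms
are the three torus-FIXED points of `F ≅ ℙ²` (full corners of the new boundary `[E₁', E₂', E₃', F]`), the points on ONE lie on the three lines
`Eᵢ' ∩ F` (orbits `O_R` of a proper face `R`, boundary corner of size `2`), the rest are generic (`{F}` only, size `1`). (EZ)(iv): a W-top point of
`X'(ν)` over `x` OFF the fixed points («off the skeleton») lies in such an orbit, so ITS BOUNDARY CORNER AT BIRTH HAS SIZE `≤ 2` — full-corner births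
land in the PARTIAL-FRAME cells (E4-partial, r-52), never back in a full OLD corner; new exceptional members may later RE-COMPLETE a corner
(`2 → 3`: the two old lines through a size-2 point meet the next `F'` in a fixed point). This file types the COMBINATORIAL half of that dictionary
— corner sizes and their one-step law — scheme-side and fact-free; the GEOMETRIC half («such births need extra vanishing of a coefficient
bracket»; births measure non-adaptedness of the transversal coordinates) is not needed for the bookkeeping and is not typed here.

## Contents (namespace `…Theorems.SigmaMaxModificationsCorridor3.Sigma`)

* §1 `cornerSize E x := (membersThrough E x).length` (the boundary-corner size `|B(x)|`), `isFullCorner_iff_three_le`.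
* §2 ONE BLOW-UP: `oldThrough E C x'` (old members whose STRICT transform passes through `x'`), `oldThrough_sublist` (⊆ members through `π x'`),
  **`cornerSize_next`** (`|B(x')| = |oldThrough| + [x' ∈ F]`), `cornerSize_next_le` (`≤ |B(π x')| + 1`), `cornerSize_next_of_not_mem` (off `F`: no gain).
* §3 THE BIRTH FACE over the centre: `IsFixedPointOver E C x'` (on `≥ 2` old strict transforms), `isFullCorner_next_iff` (on `F`: full corner ⟺ fixed
  point), **`offSkeleton_birth_face`** ((EZ)(iv)(a): on `F`, off the fixed points ⇒ corner size `≤ 2`), `fixedPointsOver_finite` (under the pair clause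
  `E.PairsMeetNewFinite C` the fixed points on `F` are finitely many — E4d's content read at births).
* §5 (rev 2; 053's N1/N3): INTRINSIC edges via `dropLast`/`IsOnNewest` (`Boundary.dropLast_next/getLast_next/take_next`, `cornerSize_map_strictTransform`,
  `isFullCorner_next_iff_two_le_dropLast`, `CanonicalNearStepσE.isFullCorner_iff_two_le_dropLast/.cornerSize_le_two_of_offSkeleton`). The run-level laws
  (053's N2 no-triple clause; plan-1's (T2) AGE datum) live in the sibling `…Corridor3SigmaBirthAges.lean`.
* §4 THE CELL-TRANSITION GRAPH ((FA)(b)): `CornerCell` (`free | single | pair | full`), `CornerCell.ofSize`, the general one-step law along a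
  boundary-threaded σ-step `CanonicalNearStepσE.cornerSize_le` (`|B(x_{n+1})| ≤ |B(x_n)| + 1`), the clause `Boundary.NoTripleOnNew E C` («no point of
  the new exceptional member lies on three old strict transforms» — transversal frame) under which a blown-up marked point lands in a cell of size
  `≤ 3` with `= 3` iff fixed point (`CanonicalNearStepσE.cornerSize_le_three`, `…isFullCorner_iff_fixed`), i.e. the typed edges
  `FULL → {FULL@fixed, PAIR, SINGLE}`, `PAIR → {FULL@fixed, PAIR, SINGLE}`, `SINGLE → {PAIR@fixed-line, SINGLE}`, `FREE → SINGLE` on `F`.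
-/

noncomputable section

set_option linter.dupNamespace false

open CategoryTheory AlgebraicGeometry TopologicalSpace
open Summit.ResolutionOfSingularities.ResolutionOfSingularities.Theorems.CampaignW42
open Literature.AlgebraicGeometry.Resolution Literature.RingTheory.HilbertSamuel

namespace Summit.ResolutionOfSingularities.ResolutionOfSingularities.Theorems.SigmaMaxModificationsCorridor3.Sigma

universe u

variable {W : Scheme.{u}}

/-! ## §1. The boundary-corner size of a point -/

/-- [OURS · L1 W4.2] **THE BOUNDARY-CORNER SIZE `|B(x)|`**: the number of boundary members through `x` (RULINGS (CT): the boundary indices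
`B(x)`; `3 ≤ |B(x)|` is `IsFullCorner`). NOT a statement of the manuscript. [folklore] -/
def cornerSize (E : Boundary W) (x : W) : ℕ :=
  (membersThrough E x).length

/-- Full corner ⟺ corner size `≥ 3` (`Iff.rfl`). [folklore] -/
theorem isFullCorner_iff_three_le {E : Boundary W} {x : W} : IsFullCorner E x ↔ 3 ≤ cornerSize E x :=
  Iff.rfl

/-- No boundary: corner size `0` (every maximal origin starts here). [folklore] -/
@[simp] theorem cornerSize_nil (x : W) : cornerSize ([] : Boundary W) x = 0 := by
  simp [cornerSize]

/-- The corner size is at most the number of boundary members. [folklore] -/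
theorem cornerSize_le_length (E : Boundary W) (x : W) : cornerSize E x ≤ E.length :=
  (membersThrough_sublist E x).length_le

/-! ## §2. One blow-up: old members through the new point -/

open scoped Classical in
/-- [OURS · L1 W4.2] **THE OLD MEMBERS THROUGH `x'`**: the members of `E` (in boundary order) whose STRICT transform under `Bl_C W → W` passes
through the point `x'` of `Bl_C W`. NOT a statement of the manuscript. [folklore] -/
def oldThrough (E : Boundary W) (C : W.IdealSheafData) (x' : ↥(blowup C)) : List W.IdealSheafData :=
  E.filter fun I => x' ∈ ((strictTransformIdeal (blowup.π C) C I).support : Set ↥(blowup C))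

/-- Membership. [folklore] -/
theorem mem_oldThrough_iff {E : Boundary W} {C : W.IdealSheafData} {x' : ↥(blowup C)} {I : W.IdealSheafData} :
    I ∈ oldThrough E C x' ↔ I ∈ E ∧ x' ∈ ((strictTransformIdeal (blowup.π C) C I).support : Set ↥(blowup C)) := by
  classical
  simp [oldThrough, List.mem_filter]

/-- **The old members through `x'` are among the members through `π x'`** (the support of a strict transform lies over the support).
[folklore] -/
theorem oldThrough_sublist [IsLocallyNoetherian W] (E : Boundary W) (C : W.IdealSheafData) (x' : ↥(blowup C)) :
    (oldThrough E C x').Sublist (membersThrough E ((blowup.π C).base x')) := by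
  classical
  have h : oldThrough E C x' = (membersThrough E ((blowup.π C).base x')).filter
      fun I => x' ∈ ((strictTransformIdeal (blowup.π C) C I).support : Set ↥(blowup C)) := by
    rw [membersThrough, List.filter_filter]
    refine List.filter_congr fun I _ => ?_
    by_cases hx : x' ∈ ((strictTransformIdeal (blowup.π C) C I).support : Set ↥(blowup C))
    · have : (blowup.π C).base x' ∈ (I.support : Set W) := mem_support_of_mem_support_strictTransformIdeal hx
      simp [hx, this]
    · simp [hx]
  rw [h]
  exact List.filter_sublist

/-- … hence their number is at most the old corner size. [folklore] -/
theorem length_oldThrough_le [IsLocallyNoetherian W] (E : Boundary W) (C : W.IdealSheafData) (x' : ↥(blowup C)) :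
    (oldThrough E C x').length ≤ cornerSize E ((blowup.π C).base x') :=
  (oldThrough_sublist E C x').length_le

open scoped Classical in
/-- **THE MEMBERS THROUGH `x'` AFTER THE BLOW-UP**: the strict transforms of the old members through `x'`, followed by the new exceptional member
if `x'` lies on it. [folklore] -/
theorem membersThrough_next (E : Boundary W) (C : W.IdealSheafData) (x' : ↥(blowup C)) :
    membersThrough (E.next C) x' = (oldThrough E C x').map (strictTransformIdeal (blowup.π C) C) ++
      (if x' ∈ ((C.comap (blowup.π C)).support : Set ↥(blowup C)) then [C.comap (blowup.π C)] else []) := by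
  classical
  rw [membersThrough, Boundary.next, List.filter_append, List.filter_map, List.filter_singleton, oldThrough]
  congr 1
  have hiff : ((blowup.π C).base x' ∈ (C.support : Set W)) ↔ x' ∈ ((C.comap (blowup.π C)).support : Set ↥(blowup C)) := by
    rw [coe_support_comap_blowup]; rfl
  by_cases h : x' ∈ ((C.comap (blowup.π C)).support : Set ↥(blowup C))
  · rw [if_pos h]; simp [hiff.mpr h]
  · rw [if_neg h]; simp [hiff.not.mpr h]

open scoped Classical in
/-- **THE CORNER SIZE AFTER THE BLOW-UP**: `|B(x')| = #(old members whose strict transform passes through x') + [x' ∈ F]`. [folklore] -/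
theorem cornerSize_next (E : Boundary W) (C : W.IdealSheafData) (x' : ↥(blowup C)) :
    cornerSize (E.next C) x' = (oldThrough E C x').length +
      (if x' ∈ ((C.comap (blowup.π C)).support : Set ↥(blowup C)) then 1 else 0) := by
  classical
  rw [cornerSize, membersThrough_next, List.length_append, List.length_map]
  split_ifs <;> simp

/-- **Corner size grows by at most one per blow-up** (and only on the new exceptional member). [folklore] -/
theorem cornerSize_next_le [IsLocallyNoetherian W] (E : Boundary W) (C : W.IdealSheafData) (x' : ↥(blowup C)) :
    cornerSize (E.next C) x' ≤ cornerSize E ((blowup.π C).base x') + 1 := by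
  classical
  rw [cornerSize_next]
  have := length_oldThrough_le E C x'
  split_ifs <;> omega

/-- Off the new exceptional member the corner size does not grow. [folklore] -/
theorem cornerSize_next_of_not_mem [IsLocallyNoetherian W] (E : Boundary W) (C : W.IdealSheafData) {x' : ↥(blowup C)}
    (hx' : x' ∉ ((C.comap (blowup.π C)).support : Set ↥(blowup C))) :
    cornerSize (E.next C) x' ≤ cornerSize E ((blowup.π C).base x') := by
  classical
  rw [cornerSize_next, if_neg hx', add_zero]
  exact length_oldThrough_le E C x'

/-! ## §3. The birth face over the centre ((EZ)(iv)(a)) -/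

/-- [OURS · L1 W4.2] **`x'` IS A FIXED POINT OVER THE CENTRE** (w.r.t. the boundary `E`): at least two OLD members have strict transforms through `x'`
(in the toric frame over a full-corner point centre: the torus-fixed points of the exceptional `ℙ²`). NOT a statement of the manuscript. [folklore] -/
def IsFixedPointOver (E : Boundary W) (C : W.IdealSheafData) (x' : ↥(blowup C)) : Prop :=
  2 ≤ (oldThrough E C x').length

/-- **ON THE NEW EXCEPTIONAL MEMBER, full corner ⟺ fixed point.** [folklore] -/
theorem isFullCorner_next_iff {E : Boundary W} {C : W.IdealSheafData} {x' : ↥(blowup C)}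
    (hx' : x' ∈ ((C.comap (blowup.π C)).support : Set ↥(blowup C))) :
    IsFullCorner (E.next C) x' ↔ IsFixedPointOver E C x' := by
  classical
  rw [isFullCorner_iff_three_le, cornerSize_next, if_pos hx', IsFixedPointOver]
  omega

/-- **(EZ)(iv)(a) — OFF-SKELETON BIRTH FACE**: a point of the new exceptional member that is NOT a fixed point over the centre has boundary corner of
size `≤ 2` («full-corner births land in the partial-frame cells»). [folklore] -/
theorem offSkeleton_birth_face {E : Boundary W} {C : W.IdealSheafData} {x' : ↥(blowup C)}
    (hx' : x' ∈ ((C.comap (blowup.π C)).support : Set ↥(blowup C))) (hfix : ¬ IsFixedPointOver E C x') :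
    cornerSize (E.next C) x' ≤ 2 := by
  classical
  rw [cornerSize_next, if_pos hx']
  rw [IsFixedPointOver] at hfix
  omega

/-- A fixed point over the centre ON the new member lies on two old strict transforms (with increasing indices) and on `F`. [folklore] -/
theorem IsFixedPointOver.exists_indices {E : Boundary W} {C : W.IdealSheafData} {x' : ↥(blowup C)} (h : IsFixedPointOver E C x') :
    ∃ i j : Fin E.length, i < j ∧ x' ∈ ((strictTransformIdeal (blowup.π C) C (E.get i)).support : Set ↥(blowup C)) ∧
      x' ∈ ((strictTransformIdeal (blowup.π C) C (E.get j)).support : Set ↥(blowup C)) := by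
  classical
  have hsub : (oldThrough E C x').Sublist E := List.filter_sublist
  obtain ⟨f, hf⟩ := List.sublist_iff_exists_fin_orderEmbedding_get_eq.mp hsub
  have hlen : 2 ≤ (oldThrough E C x').length := h
  have hmem : ∀ a : Fin (oldThrough E C x').length,
      x' ∈ ((strictTransformIdeal (blowup.π C) C (E.get (f a))).support : Set ↥(blowup C)) := fun a => by
    rw [← hf a]
    exact (mem_oldThrough_iff.mp (List.get_mem _ a)).2
  exact ⟨f ⟨0, by omega⟩, f ⟨1, by omega⟩, f.lt_iff_lt.mpr (by simp [Fin.lt_def]), hmem _, hmem _⟩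

/-- **UNDER THE PAIR CLAUSE THE FIXED POINTS ON THE NEW MEMBER ARE FINITELY MANY** (E4d read at births: only finitely many full-corner births per
blow-up). [folklore] -/
theorem fixedPointsOver_finite {E : Boundary W} {C : W.IdealSheafData} (hP : E.PairsMeetNewFinite C) :
    {x' : ↥(blowup C) | x' ∈ ((C.comap (blowup.π C)).support : Set ↥(blowup C)) ∧ IsFixedPointOver E C x'}.Finite := by
  have hfin : (⋃ t : Fin E.length × Fin E.length, {y : ↥(blowup C) | t.1 < t.2 ∧
      y ∈ (((strictTransformIdeal (blowup.π C) C (E.get t.1)).support : Set ↥(blowup C)) ∩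
        (strictTransformIdeal (blowup.π C) C (E.get t.2)).support ∩ (C.comap (blowup.π C)).support)}).Finite := by
    refine Set.finite_iUnion fun t => ?_
    by_cases ht : t.1 < t.2
    · exact (hP t.1 t.2 ht).subset fun y hy => hy.2
    · exact Set.finite_empty.subset fun y hy => ht hy.1
  refine hfin.subset ?_
  rintro y ⟨hyF, hfix⟩
  obtain ⟨i, j, hij, hi, hj⟩ := hfix.exists_indices
  exact Set.mem_iUnion.mpr ⟨(i, j), hij, ⟨hi, hj⟩, hyF⟩

/-! ## §4. The cell-transition graph ((FA)(b)) -/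

/-- [OURS · L1 W4.2] **THE CORNER CELLS** of the elimination line (RULINGS (CT)/(BR-7): E4-corner = FULL, E4-partial = PAIR/SINGLE, and FREE = no
boundary member, where every maximal origin starts). NOT a statement of the manuscript. [folklore] -/
inductive CornerCell : Type
  | free
  | single
  | pair
  | full

/-- The cell of a corner size (`≥ 3` ↦ `full`). [folklore] -/
def CornerCell.ofSize : ℕ → CornerCell
  | 0 => .free
  | 1 => .single
  | 2 => .pair
  | _ + 3 => .full

/-- [OURS · L1 W4.2] the cell of the point `x` for the boundary `E`. [folklore] -/
def cornerCell (E : Boundary W) (x : W) : CornerCell :=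
  CornerCell.ofSize (cornerSize E x)

/-- The full cell is the full-corner predicate. [folklore] -/
theorem cornerCell_eq_full_iff {E : Boundary W} {x : W} : cornerCell E x = .full ↔ IsFullCorner E x := by
  rw [isFullCorner_iff_three_le, cornerCell]
  rcases h : cornerSize E x with _ | _ | _ | n <;> simp [CornerCell.ofSize]

/-- [OURS · L1 W4.2] **NO TRIPLE ON THE NEW MEMBER**: no point of the new exceptional member lies on THREE old strict transforms (the transversal /
toric frame: the strict transforms of the members through a point centre meet the exceptional `ℙ²` in lines in general position). The clause under
which a blown-up marked point lands in a cell of size `≤ 3`, `= 3` exactly at the fixed points. NOT a statement of the manuscript. [folklore] -/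
def Boundary.NoTripleOnNew (E : Boundary W) (C : W.IdealSheafData) : Prop :=
  ∀ x' : ↥(blowup C), x' ∈ ((C.comap (blowup.π C)).support : Set ↥(blowup C)) → (oldThrough E C x').length ≤ 2

/-- Under the clause, a point of the new member has corner size `≤ 3` … [folklore] -/
theorem cornerSize_next_le_three {E : Boundary W} {C : W.IdealSheafData} (hT : E.NoTripleOnNew C) {x' : ↥(blowup C)}
    (hx' : x' ∈ ((C.comap (blowup.π C)).support : Set ↥(blowup C))) : cornerSize (E.next C) x' ≤ 3 := by
  classical
  rw [cornerSize_next, if_pos hx']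
  have := hT x' hx'
  omega

/-- … with equality exactly at the fixed points over the centre. [folklore] -/
theorem cornerSize_next_eq_three_iff {E : Boundary W} {C : W.IdealSheafData} (hT : E.NoTripleOnNew C) {x' : ↥(blowup C)}
    (hx' : x' ∈ ((C.comap (blowup.π C)).support : Set ↥(blowup C))) : cornerSize (E.next C) x' = 3 ↔ IsFixedPointOver E C x' := by
  classical
  rw [cornerSize_next, if_pos hx', IsFixedPointOver]
  have := hT x' hx'
  omega

/-- **THE ONE-STEP LAW ALONG A σ-STEP (boundary threaded)**: the marked point's corner size grows by at most one. [folklore] -/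
theorem CanonicalNearStepσE.cornerSize_le {σ : StrategyE.{u}} {N : ℕ} {ν : ℕ → ℕ} {s s' : MarkedStageE.{u}}
    (h : CanonicalNearStepσE σ N ν s s') : cornerSize s'.E s'.pt ≤ cornerSize s.E s.pt + 1 := by
  obtain ⟨C, P', hln, x', -, hπ, -, -, rfl⟩ := h
  haveI := s.ln
  have := cornerSize_next_le s.E C x'
  rw [hπ] at this
  exact this

/-- **THE TYPED EDGES**: along a σ-step whose centre is blown up at a point LYING ON the new exceptional member, under the no-triple clause the new
marked point is in a cell of size `≤ 3`, and it is FULL iff it is a fixed point over the centre — edges `FULL/PAIR/SINGLE/FREE → {FULL@fixed, PAIR,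
SINGLE}` on `F`; off `F` the size does not grow (`cornerSize_next_of_not_mem`). [folklore] -/
theorem CanonicalNearStepσE.isFullCorner_iff_fixed {σ : StrategyE.{u}} {N : ℕ} {ν : ℕ → ℕ} {s s' : MarkedStageE.{u}}
    (h : CanonicalNearStepσE σ N ν s s') :
    ∃ (C : s.W.IdealSheafData) (e : s'.W = blowup C) (x' : ↥(blowup C)), s'.E = e ▸ s.E.next C ∧
      (x' ∈ ((C.comap (blowup.π C)).support : Set ↥(blowup C)) → (IsFullCorner (s.E.next C) x' ↔ IsFixedPointOver s.E C x')) ∧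
      (s.E.NoTripleOnNew C → x' ∈ ((C.comap (blowup.π C)).support : Set ↥(blowup C)) → cornerSize (s.E.next C) x' ≤ 3) := by
  obtain ⟨C, P', hln, x', -, -, -, -, rfl⟩ := h
  exact ⟨C, rfl, x', rfl, fun hx' => isFullCorner_next_iff hx', fun hT hx' => cornerSize_next_le_three hT hx'⟩

/-! ## §5 (appended 2026-08-27, same seat, rev 2; res-type-053 READER'S WORD 12:26:28Z (N1)/(N3)). INTRINSIC EDGES AT THE MARKED POINT.
Along a boundary-threaded σ-step the new boundary is `s'.E = (map sT s.E) ++ [F]`: the members OLDER than the step are `s'.E.dropLast`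
(= `s'.E.take |s.E|`), the newest is `s'.E.getLast`. So the old members through the marked point are read INSIDE `s'` (no centre, no cast).
(N3, for §0's readers): (EZ)(iv) speaks of the marked POINT's cell; a depth-jump REBIRTH at the same step may swallow a whole fibre COMPONENT
through the new fixed points (res-type-053 p528979 / its σ-port) — the newborn component's reach is not bounded by the point's cell. -/

/-- The members older than the blow-up: `(E.next C).dropLast = map sT E`. [folklore] -/
@[simp] theorem Boundary.dropLast_next (E : Boundary W) (C : W.IdealSheafData) :
    (E.next C).dropLast = E.map (strictTransformIdeal (blowup.π C) C) := by
  simp [Boundary.next]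

/-- The newest member after the blow-up is the new exceptional member. [folklore] -/
theorem Boundary.next_ne_nil (E : Boundary W) (C : W.IdealSheafData) : E.next C ≠ [] := by
  simp [Boundary.next]

/-- … namely `V(C·𝒪_{Bl})`. [folklore] -/
@[simp] theorem Boundary.getLast_next (E : Boundary W) (C : W.IdealSheafData) :
    (E.next C).getLast (E.next_ne_nil C) = C.comap (blowup.π C) := by
  simp [Boundary.next]

/-- The members older than age `k ≤ |E|` after the blow-up are the strict transforms of the members older than `k`. [folklore] -/
theorem Boundary.take_next (E : Boundary W) (C : W.IdealSheafData) {k : ℕ} (hk : k ≤ E.length) :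
    (E.next C).take k = (E.take k).map (strictTransformIdeal (blowup.π C) C) := by
  rw [Boundary.next, List.take_append_of_le_length (by simpa using hk), List.map_take]

/-- **Corner size w.r.t. strict transforms = number of old members (of the sub-boundary) whose strict transform passes through the point.** [folklore] -/
theorem cornerSize_map_strictTransform (E : Boundary W) (C : W.IdealSheafData) (x' : ↥(blowup C)) :
    cornerSize (E.map (strictTransformIdeal (blowup.π C) C)) x' = (oldThrough E C x').length := by
  classical
  rw [cornerSize, membersThrough, List.filter_map, List.length_map, oldThrough]
  rfl

/-- Hence it does not exceed the corner size of the image point w.r.t. the sub-boundary. [folklore] -/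
theorem cornerSize_map_strictTransform_le [IsLocallyNoetherian W] (E : Boundary W) (C : W.IdealSheafData) (x' : ↥(blowup C)) :
    cornerSize (E.map (strictTransformIdeal (blowup.π C) C)) x' ≤ cornerSize E ((blowup.π C).base x') := by
  rw [cornerSize_map_strictTransform]; exact length_oldThrough_le E C x'

/-- [OURS · L1 W4.2] **`x` LIES ON THE NEWEST MEMBER** of the boundary (after a blow-up: on the new exceptional member). NOT a statement of the
manuscript. [folklore] -/
def IsOnNewest (E : Boundary W) (x : W) : Prop :=
  ∃ h : E ≠ [], x ∈ ((E.getLast h).support : Set W)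

/-- After a blow-up: on the newest member ⟺ on `V(C·𝒪_{Bl})`. [folklore] -/
theorem isOnNewest_next_iff {E : Boundary W} {C : W.IdealSheafData} {x' : ↥(blowup C)} :
    IsOnNewest (E.next C) x' ↔ x' ∈ ((C.comap (blowup.π C)).support : Set ↥(blowup C)) := by
  constructor
  · rintro ⟨h, hx⟩
    rwa [Boundary.getLast_next] at hx
  · intro hx
    exact ⟨E.next_ne_nil C, by rwa [Boundary.getLast_next]⟩

/-- **(N1) INTRINSIC full-corner criterion after a blow-up**: on the newest member, FULL ⟺ at least two OLDER members pass through the point. [folklore] -/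
theorem isFullCorner_next_iff_two_le_dropLast {E : Boundary W} {C : W.IdealSheafData} {x' : ↥(blowup C)} (hx' : IsOnNewest (E.next C) x') :
    IsFullCorner (E.next C) x' ↔ 2 ≤ cornerSize (E.next C).dropLast x' := by
  rw [isFullCorner_next_iff (isOnNewest_next_iff.mp hx'), IsFixedPointOver, Boundary.dropLast_next, cornerSize_map_strictTransform]

/-- **(N1) along a σ-step, tied to the marked point**: if `x_{n+1}` lies on the newest member, then `x_{n+1}` is a FULL corner iff at least two OLDER
members pass through it. [folklore] -/
theorem CanonicalNearStepσE.isFullCorner_iff_two_le_dropLast {σ : StrategyE.{u}} {N : ℕ} {ν : ℕ → ℕ} {s s' : MarkedStageE.{u}}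
    (h : CanonicalNearStepσE σ N ν s s') (hx' : IsOnNewest s'.E s'.pt) :
    IsFullCorner s'.E s'.pt ↔ 2 ≤ cornerSize s'.E.dropLast s'.pt := by
  obtain ⟨C, P', hln, x', -, -, -, -, rfl⟩ := h
  exact isFullCorner_next_iff_two_le_dropLast hx'

/-- **(N1) along a σ-step, off-skeleton birth**: on the newest member with at most one older member through it, the marked point's corner has size
`≤ 2`. [folklore] -/
theorem CanonicalNearStepσE.cornerSize_le_two_of_offSkeleton {σ : StrategyE.{u}} {N : ℕ} {ν : ℕ → ℕ} {s s' : MarkedStageE.{u}}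
    (h : CanonicalNearStepσE σ N ν s s') (hx' : IsOnNewest s'.E s'.pt) (hoff : cornerSize s'.E.dropLast s'.pt ≤ 1) :
    cornerSize s'.E s'.pt ≤ 2 := by
  obtain ⟨C, P', hln, x', -, -, -, -, rfl⟩ := h
  have hF : x' ∈ ((C.comap (blowup.π C)).support : Set ↥(blowup C)) := isOnNewest_next_iff.mp hx'
  have hoff' : cornerSize (Boundary.next s.E C).dropLast x' ≤ 1 := hoff
  rw [Boundary.dropLast_next, cornerSize_map_strictTransform] at hoff'
  show cornerSize (Boundary.next s.E C) x' ≤ 2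
  refine offSkeleton_birth_face hF fun hfix => ?_
  rw [IsFixedPointOver] at hfix
  omega

end Summit.ResolutionOfSingularities.ResolutionOfSingularities.Theorems.SigmaMaxModificationsCorridor3.Sigma

end
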